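/-
Copyright (c) 2026 the pub-hodgecm-mathlib formalisation cell (harness21).  Prover seat hodgecm-mathlib-F0P3a-p03 (g20), 2026-09-02 (LH7 leaf ED. 3 road, O8b census §1:
the algebraic LOCAL half of the isotypy letter (O8b♭)).
-/
import Literature.NumberTheory.Automorphic.IrreducibleClassesConstituents
import Literature.NumberTheory.Automorphic.SmoothCharacterOfCharacter
import HarnessLib

/-!
# A smooth representation with a UNIQUE constituent, a character `χ`, is `χ`-isotypic on every compact subgroup

Topic `NumberTheory/Automorphic`; namespace `Literature.NumberTheory.Automorphic` (dot notation on ★ `IrrClass`).  THEOREMS ONLY: no definition, no named fact, no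
instance, no notation, no `sorry`.  Generic smooth representation theory over `ℂ` of a topological group `G` ([BernsteinZelevinsky1976] §2.1–§2.3; [BushnellHenniart2006] §2,
§9.1; [Casselman1995] §2.1), consumed by the «`π_v` is a character» currency of the cell `hodgecm-mathlib` (crux H413, line LH7: the letter O8b ∕ (O8b♭) «a discrete automorphic `P₂`
of `U(Φ₂)` realising the character family `χ_v` is `χ`-scalar», ★ `Theorems/F0P3cPKtupleU2LineUnique`).

THE MATHEMATICS.  Let `ρ` be a smooth representation of `G` on `V` and `χ : G →* ℂˣ` a smooth character (open kernel).  Suppose EVERY constituent of `ρ` (★ `IrrClass.IsConstituentOf`: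
the class of an irreducible smooth subquotient) is the class of ONE irreducible `τ` on which `G` acts through `χ` (e.g. `τ = ℂ_χ`, ★ `SmoothIrrep.ofChar χ`).  Then every subgroup `H ≤ G`
contained in a compact set — in particular every compact open subgroup — acts on `V` through `χ`: `ρ h v = χ(h) v`.  PROOF.  Put `ρ′ := ρ ⊗ χ⁻¹` (★ `Representation.twist`, smooth by ★
`IsSmooth.twist`) and `x := ρ′ h v − v`.  (A) The finite averaging projector ★ `SmoothProjector.avg` of `H` on `ρ′` is linear on smooth vectors and `H`-invariant, so `e_H x = 0`, i.e.
`∑_{q ∈ H ∕ Stab_H(x)} ρ′(q̃) x = 0` (★ `avg_eq_index_inv_smul_finsum`).  (B) If `x ≠ 0`, the cyclic `ℂ[G]`-module `N₁ = ℂ[G] x ≤ ρ` is finitely generated, so it has a maximal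
proper `G`-stable `N₂` (★ `Representation.exists_isCoatom_subrepresentation`) with irreducible smooth quotient `r = N₁ ∕ N₂` (★ `Subrepresentation.isIrreducible_quotientRep`); `⟦r⟧` is a
constituent of `ρ`, hence `⟦r⟧ = ⟦τ⟧` and `G` acts on `r` through `χ`.  (C) So the quotient map `q : N₁ → r` satisfies `q(χ(g)⁻¹ ρ(g) y) = q(y)`; applying `q` to the vanishing sum of (A)
(whose terms lie in `N₁`) gives `[H : Stab_H(x)] · q(x) = 0`, so `x ∈ N₂`.  (D) But `x` generates `N₁`, so `N₂ = N₁` — contradiction.  Hence `x = 0`, i.e. `ρ h v = χ(h) v`.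
NOT HERE (honest scope): isotypy on the whole group.  The subgroup `G°` generated by the compact subgroups acts through `χ` by this file; on `G ∕ G°` nothing is claimed and nothing
is true in general — for `G = GL₂(F)`, `F` non-archimedean, `G ∕ G° ≅ ℤ` via `ord ∘ det` and `g ↦ [[1, ord (det g)], [0, 1]]` is a smooth admissible representation whose only
constituent is the trivial character but which is not trivial.  (For unitary representations the complementary statement holds; that is the analytic half of (O8b♭).)

* §1 `IrrClass.apply_eq_smul_of_forall_isConstituentOf_eq` — the theorem above (`τ`, `χ` abstract: `hτ : ∀ g z, τ.ρ g z = χ g • z`);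
  `IrrClass.apply_eq_self_of_forall_isConstituentOf_eq` (`χ = 1`: compact subgroups act trivially);
* §2 `IrrClass.apply_eq_smul_of_forall_isConstituentOf_eq_mk_ofChar` ∕ `…_eq_self_of_forall_isConstituentOf_eq_mk_ofChar_one` — the same with `τ := ℂ_χ` (★ `SmoothIrrep.ofChar χ hχ`),
  the currency of ★ `Realises₂` ∕ ★ `LocalConstituentsIn`; `IrrClass.mem_fixedPoints_of_forall_isConstituentOf_eq_mk_ofChar_one` (`V = V^K` for every compact `K`);
* §3 (ED. 2, append-only) `IrrClass.apply_eq_smul_of_forall_isConstituentOf_eq_of_mem_closure` — the subgroup `G°` generated by the subgroups contained in compact sets acts through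
  `χ`; `…_of_closure_eq_top` forms: a group GENERATED by its compact subgroups is `χ`-isotypic (resp. trivial) under the unique-constituent hypothesis.

## References
* [BernsteinZelevinsky1976] I. N. Bernstein, A. V. Zelevinsky, *Representations of the group GL(n,F) where F is a non-archimedean local field*, Russian Math. Surveys 31:3
  (1976) 1–68, §2.1–§2.3 (smooth representations, the projectors `e_K`, subquotients).
* [BushnellHenniart2006] C. J. Bushnell, G. Henniart, *The local Langlands conjecture for GL(2)*, Grundlehren 335 (2006), §2 (§2.3 Lemma: `V = V^K ⊕ V(K)`), §9.1 (twisting).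
* [Casselman1995] W. Casselman, *Introduction to the theory of admissible representations of p-adic reductive groups* (1995 notes), §2.1 (the projector `P_K`).
-/

set_option autoImplicit false

noncomputable section

open scoped MonoidAlgebra

namespace Literature.NumberTheory.Automorphic

namespace IrrClass

open Literature.NumberTheory.Automorphic.SmoothProjector
open Literature.RepresentationTheory.Semisimple

universe u

variable {G : Type u} [Group G] [TopologicalSpace G] [IsTopologicalGroup G]

/-! ## §1 Unique constituent with a scalar action ⇒ the same scalar action on every compact subgroup -/

/-- **A smooth representation whose only constituent is a `χ`-scalar irreducible `τ` is `χ`-isotypic on every subgroup contained in a compact set.**  Let `ρ` be a smooth representation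
of the topological group `G` on `V`, `χ : G →* ℂˣ` a character with open kernel, `τ` an irreducible smooth representation on which `G` acts through `χ` (`hτ`), and suppose every
constituent of `ρ` (★ `IrrClass.IsConstituentOf`, irreducible smooth subquotients) is `⟦τ⟧` (`hconst`).  Then for every subgroup `H ≤ G` with `IsCompact ↑H`, every `h ∈ H` and every
`v ∈ V`: `ρ h v = χ(h) • v`.  (Twist by `χ⁻¹`, average over `H` with ★ `SmoothProjector.avg`, and read the vanishing average in the irreducible quotient of the cyclic subrepresentation
through `ρ′ h v − v`, which is `⟦τ⟧` by hypothesis; see the module docstring.)  Nothing is claimed off the compact subgroups (false in general for `GL₂(F)`).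
[cite: BernsteinZelevinsky1976, §2.1–§2.3] [cite: BushnellHenniart2006, §2.3 Lemma; §9.1] [cite: Casselman1995, §2.1] -/
theorem apply_eq_smul_of_forall_isConstituentOf_eq {V : Type} [AddCommGroup V] [Module ℂ V]
    (ρ : Representation ℂ G V) (hρ : ρ.IsSmooth) (χ : G →* ℂˣ) (hχ : IsOpen ((χ.ker : Subgroup G) : Set G))
    (τ : SmoothIrrep G) (hτ : ∀ (g : G) (z : τ.V), τ.ρ g z = ((χ g : ℂˣ) : ℂ) • z)
    (hconst : ∀ c : IrrClass G, c.IsConstituentOf ρ → c = IrrClass.mk τ)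
    (H : Subgroup G) (hH : IsCompact (H : Set G)) {h : G} (hh : h ∈ H) (v : V) :
    ρ h v = ((χ h : ℂˣ) : ℂ) • v := by
  -- the twisted representation `ρ' = ρ ⊗ χ⁻¹` (same space, same subrepresentations), smooth
  have hker : (((χ⁻¹ : G →* ℂˣ).ker : Subgroup G) : Set G) = ((χ.ker : Subgroup G) : Set G) := by
    ext g
    simp only [SetLike.mem_coe, MonoidHom.mem_ker, MonoidHom.inv_apply, inv_eq_one]
  have hρ' : (ρ.twist χ⁻¹).IsSmooth := hρ.twist (χ := χ⁻¹) (by rw [hker]; exact hχ)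
  -- it suffices to show `x := ρ' h v - v = 0`
  suffices hx0 : ρ.twist χ⁻¹ h v - v = 0 by
    have h1 : ((χ⁻¹ h : ℂˣ) : ℂ) • ρ h v = v := by rw [← Representation.twist_apply]; exact sub_eq_zero.1 hx0
    have h2 := congrArg (fun w => ((χ h : ℂˣ) : ℂ) • w) h1
    simp only [smul_smul, MonoidHom.inv_apply, Units.val_inv_eq_inv_val, mul_inv_cancel₀ (Units.ne_zero (χ h)), one_smul] at h2
    exact h2
  set x : V := ρ.twist χ⁻¹ h v - v with hxdef
  by_contra hx
  -- (A) the `H`-average of `x` in `ρ'` vanishes, as a finite coset sum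
  haveI hBfi : (stabIn (ρ.twist χ⁻¹) H x).FiniteIndex := finiteIndex_stabIn hH (hρ' x)
  haveI : Fintype (H ⧸ stabIn (ρ.twist χ⁻¹) H x) := Fintype.ofFinite _
  have havg : avg (ρ.twist χ⁻¹) H x = 0 := by
    have h1 := (avgLinear H hρ' hH).map_sub (ρ.twist χ⁻¹ h v) v
    rw [avgLinear_apply, avgLinear_apply, avgLinear_apply, avg_apply_of_mem hh, sub_self] at h1
    exact h1
  have hsum : ∑ q : H ⧸ stabIn (ρ.twist χ⁻¹) H x, ρ.twist χ⁻¹ ((q.out : H) : G) x = 0 := by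
    have h1 := avg_eq_index_inv_smul_finsum (ρ := ρ.twist χ⁻¹) (H := H) (v := x) (stabIn (ρ.twist χ⁻¹) H x) le_rfl
    rw [havg, finsum_eq_sum_of_fintype] at h1
    have hne : ((((stabIn (ρ.twist χ⁻¹) H x).index : ℕ) : ℂ))⁻¹ ≠ 0 :=
      inv_ne_zero (Nat.cast_ne_zero.2 Subgroup.FiniteIndex.index_ne_zero)
    exact (smul_eq_zero.1 h1.symm).resolve_left hne
  -- (B) the cyclic subrepresentation `N₁ = ℂ[G] x` of `ρ` and an irreducible quotient `r = N₁ ⁄ N₂`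
  let S : Submodule ℂ[G] ρ.asModule := Submodule.span ℂ[G] {ρ.asModuleEquiv.symm x}
  let N₁ : Subrepresentation ρ := Subrepresentation.ofSubmodule' S
  have hxS : ρ.asModuleEquiv.symm x ∈ S := Submodule.subset_span (Set.mem_singleton _)
  have hxN₁ : x ∈ N₁ := hxS
  haveI : Nontrivial ↥N₁.toSubmodule := ⟨⟨⟨x, hxN₁⟩, 0, fun h0 => hx (congrArg Subtype.val h0)⟩⟩
  haveI : Module.Finite ℂ[G] ↥S := Module.Finite.span_singleton ℂ[G] _
  have hS : S = N₁.asSubmodule := rfl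
  haveI : Module.Finite ℂ[G] N₁.toRepresentation.asModule :=
    Module.Finite.equiv ((LinearEquiv.ofEq _ _ hS).trans (Subrepresentation.asModuleEquiv N₁).symm)
  obtain ⟨N₂, hN₂⟩ := Representation.exists_isCoatom_subrepresentation N₁.toRepresentation
  have hirr : N₂.quotientRep.IsIrreducible := Subrepresentation.isIrreducible_quotientRep hN₂
  have hsm : N₂.quotientRep.IsSmooth := (hρ.toRepresentation N₁).quotientRep N₂
  let r : SmoothIrrep G :=
    { V := ↥N₁.toSubmodule ⧸ N₂.toSubmodule, ρ := N₂.quotientRep, isIrreducible := hirr, isSmooth := hsm }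
  -- `⟦r⟧` is a constituent of `ρ`, hence `⟦r⟧ = ⟦τ⟧`, hence `G` acts on `r` through `χ`
  have hcr : (IrrClass.mk r).IsConstituentOf ρ :=
    ((isConstituentOf_mk_self r).of_quotientRep N₂).of_subrepresentation N₁
  obtain ⟨e⟩ := (IrrClass.mk_eq_mk_iff r τ).1 (hconst _ hcr)
  have hquot : ∀ (g : G) (z : r.V), r.ρ g z = ((χ g : ℂˣ) : ℂ) • z := by
    intro g z
    have h1 := e.toIntertwiningMap.isIntertwining r.ρ τ.ρ g z
    rw [hτ, ← map_smul] at h1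
    exact e.toLinearEquiv.injective h1
  -- (C) the quotient map kills `x`: apply it to the (lifted) vanishing coset sum
  set x₁ : ↥N₁.toSubmodule := ⟨x, hxN₁⟩ with hx₁def
  have hmk : ∀ (g : G) (y : ↥N₁.toSubmodule), N₂.mkQ (N₁.toRepresentation g y) = ((χ g : ℂˣ) : ℂ) • N₂.mkQ y := fun g y => by
    rw [N₂.mkQ.isIntertwining]
    exact hquot g _
  have hcoe : ∀ (g : G) (y : ↥N₁.toSubmodule), ((N₁.toRepresentation g y : ↥N₁.toSubmodule) : V) = ρ g y := fun _ _ => rfl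
  have hsumN : ∑ q : H ⧸ stabIn (ρ.twist χ⁻¹) H x,
      ((χ⁻¹ ((q.out : H) : G) : ℂˣ) : ℂ) • N₁.toRepresentation ((q.out : H) : G) x₁ = 0 := by
    apply Subtype.ext
    rw [AddSubmonoidClass.coe_finsetSum, ZeroMemClass.coe_zero, ← hsum]
    refine Finset.sum_congr rfl fun q _ => ?_
    rw [SetLike.val_smul, hcoe, Representation.twist_apply]
  have hmk0 : N₂.mkQ x₁ = 0 := by
    have h1 := congrArg N₂.mkQ hsumN
    rw [map_sum, map_zero] at h1
    have h2 : ∀ q : H ⧸ stabIn (ρ.twist χ⁻¹) H x,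
        N₂.mkQ (((χ⁻¹ ((q.out : H) : G) : ℂˣ) : ℂ) • N₁.toRepresentation ((q.out : H) : G) x₁) = N₂.mkQ x₁ := fun q => by
      rw [map_smul, hmk, smul_smul, MonoidHom.inv_apply, Units.val_inv_eq_inv_val, inv_mul_cancel₀ (Units.ne_zero _), one_smul]
    rw [Finset.sum_congr rfl fun q _ => h2 q, Finset.sum_const, Finset.card_univ, ← Nat.cast_smul_eq_nsmul ℂ] at h1
    exact (smul_eq_zero.1 h1).resolve_left (Nat.cast_ne_zero.2 Fintype.card_ne_zero)
  have hxN₂ : x₁ ∈ N₂ := (N₂.mkQ_eq_zero_iff x₁).1 hmk0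
  -- (D) `x` generates `N₁`, so `N₂ = ⊤`: contradiction with maximality
  apply hN₂.1
  let M : Subrepresentation ρ :=
    ⟨N₂.toSubmodule.map N₁.toSubmodule.subtype, fun g w hw => by
      obtain ⟨y, hy, rfl⟩ := hw
      exact ⟨N₁.toRepresentation g y, N₂.apply_mem_toSubmodule g hy, rfl⟩⟩
  have hxM : x ∈ M := ⟨x₁, hxN₂, rfl⟩
  have hxM' : ρ.asModuleEquiv.symm x ∈ M.asSubmodule := hxM
  have hSM : S ≤ M.asSubmodule := Submodule.span_le.2 (Set.singleton_subset_iff.2 hxM')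
  refine eq_top_iff.2 fun y _ => ?_
  have hy : (y : V) ∈ M := hSM (show ρ.asModuleEquiv.symm (y : V) ∈ S from y.2)
  obtain ⟨z, hz, hzy⟩ := hy
  have hzy' : z = y := Subtype.ext hzy
  exact hzy' ▸ hz

/-- **`χ = 1`: a smooth representation whose only constituent is an irreducible `τ` with TRIVIAL `G`-action is trivial on every subgroup contained in a compact set** (`ρ h v = v`).
[cite: BernsteinZelevinsky1976, §2.1–§2.3] [cite: BushnellHenniart2006, §2.3 Lemma] -/
theorem apply_eq_self_of_forall_isConstituentOf_eq {V : Type} [AddCommGroup V] [Module ℂ V]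
    (ρ : Representation ℂ G V) (hρ : ρ.IsSmooth)
    (τ : SmoothIrrep G) (hτ : ∀ (g : G) (z : τ.V), τ.ρ g z = z)
    (hconst : ∀ c : IrrClass G, c.IsConstituentOf ρ → c = IrrClass.mk τ)
    (H : Subgroup G) (hH : IsCompact (H : Set G)) {h : G} (hh : h ∈ H) (v : V) :
    ρ h v = v := by
  have h1 : IsOpen (((1 : G →* ℂˣ).ker : Subgroup G) : Set G) := by
    rw [MonoidHom.ker_one]; exact isOpen_univ
  have h2 := apply_eq_smul_of_forall_isConstituentOf_eq ρ hρ 1 h1 τ (fun g z => by rw [hτ, MonoidHom.one_apply, Units.val_one, one_smul]) hconst H hH hh v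
  rwa [MonoidHom.one_apply, Units.val_one, one_smul] at h2

/-! ## §2 The currency `⟦ℂ_χ⟧ = IrrClass.mk (SmoothIrrep.ofChar χ hχ)` -/

/-- **A smooth representation whose only constituent is the character `χ` (★ `SmoothIrrep.ofChar χ hχ`) is `χ`-isotypic on every subgroup contained in a compact set**: `ρ h v = χ(h) • v`
for `h ∈ H`, `IsCompact ↑H`.  This is the shape in which «the finite constituents of `P` at `v` are `{⟦χ_v⟧}`» (★ `Realises₂`, ★ `LocalConstituentsIn`) is stated in the cell.
[cite: BernsteinZelevinsky1976, §2.1–§2.3] [cite: BushnellHenniart2006, §2.3 Lemma; §9.1] -/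
theorem apply_eq_smul_of_forall_isConstituentOf_eq_mk_ofChar {V : Type} [AddCommGroup V] [Module ℂ V]
    (ρ : Representation ℂ G V) (hρ : ρ.IsSmooth) (χ : G →* ℂˣ) (hχ : IsOpen ((χ.ker : Subgroup G) : Set G))
    (hconst : ∀ c : IrrClass G, c.IsConstituentOf ρ → c = IrrClass.mk (SmoothIrrep.ofChar χ hχ))
    (H : Subgroup G) (hH : IsCompact (H : Set G)) {h : G} (hh : h ∈ H) (v : V) :
    ρ h v = ((χ h : ℂˣ) : ℂ) • v :=
  apply_eq_smul_of_forall_isConstituentOf_eq ρ hρ χ hχ (SmoothIrrep.ofChar χ hχ)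
    (fun g z => by rw [SmoothIrrep.ofChar_ρ_apply]; rfl) hconst H hH hh v

/-- **A smooth representation whose only constituent is the trivial character is trivial on every subgroup contained in a compact set.**
[cite: BernsteinZelevinsky1976, §2.1–§2.3] [cite: BushnellHenniart2006, §2.3 Lemma] -/
theorem apply_eq_self_of_forall_isConstituentOf_eq_mk_ofChar_one {V : Type} [AddCommGroup V] [Module ℂ V]
    (ρ : Representation ℂ G V) (hρ : ρ.IsSmooth) (h1 : IsOpen (((1 : G →* ℂˣ).ker : Subgroup G) : Set G))
    (hconst : ∀ c : IrrClass G, c.IsConstituentOf ρ → c = IrrClass.mk (SmoothIrrep.ofChar 1 h1))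
    (H : Subgroup G) (hH : IsCompact (H : Set G)) {h : G} (hh : h ∈ H) (v : V) :
    ρ h v = v := by
  have h2 := apply_eq_smul_of_forall_isConstituentOf_eq_mk_ofChar ρ hρ 1 h1 hconst H hH hh v
  rwa [MonoidHom.one_apply, Units.val_one, one_smul] at h2

/-- **`V = V^K`**: under the hypothesis of `apply_eq_self_of_forall_isConstituentOf_eq_mk_ofChar_one`, every vector is fixed by every subgroup `K` contained in a compact set (Mathlib
`Representation.fixedPoints`). [cite: BernsteinZelevinsky1976, §2.3] [cite: BushnellHenniart2006, §2.3 Lemma] -/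
theorem mem_fixedPoints_of_forall_isConstituentOf_eq_mk_ofChar_one {V : Type} [AddCommGroup V] [Module ℂ V]
    (ρ : Representation ℂ G V) (hρ : ρ.IsSmooth) (h1 : IsOpen (((1 : G →* ℂˣ).ker : Subgroup G) : Set G))
    (hconst : ∀ c : IrrClass G, c.IsConstituentOf ρ → c = IrrClass.mk (SmoothIrrep.ofChar 1 h1))
    (K : Subgroup G) (hK : IsCompact (K : Set G)) (v : V) : v ∈ ρ.fixedPoints K :=
  (Representation.mem_fixedPoints _ _ _).2 fun _ hk => apply_eq_self_of_forall_isConstituentOf_eq_mk_ofChar_one ρ hρ h1 hconst K hK hk v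

/-! ## §3 (ED. 2) The subgroup generated by the compact subgroups acts through `χ` -/

/-- **ED. 2. The subgroup `G°` generated by the subgroups of `G` contained in compact sets acts through `χ`** on a smooth representation whose only constituent is the `χ`-scalar
irreducible `τ`: if `g` lies in the subgroup closure of `⋃ {K ≤ G | IsCompact ↑K}`, then `ρ g v = χ(g) • v` (§1 on each generator; the set of `g` acting through `χ` is a subgroup).
In particular a group GENERATED by its compact subgroups (e.g. `SL₂(F)`, `F` non-archimedean) acts through `χ`. [cite: BernsteinZelevinsky1976, §2.1–§2.3] [cite: BushnellHenniart2006, §2.3 Lemma; §9.1] -/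
theorem apply_eq_smul_of_forall_isConstituentOf_eq_of_mem_closure {V : Type} [AddCommGroup V] [Module ℂ V]
    (ρ : Representation ℂ G V) (hρ : ρ.IsSmooth) (χ : G →* ℂˣ) (hχ : IsOpen ((χ.ker : Subgroup G) : Set G))
    (τ : SmoothIrrep G) (hτ : ∀ (g : G) (z : τ.V), τ.ρ g z = ((χ g : ℂˣ) : ℂ) • z)
    (hconst : ∀ c : IrrClass G, c.IsConstituentOf ρ → c = IrrClass.mk τ)
    {g : G} (hg : g ∈ Subgroup.closure (⋃ K ∈ {K : Subgroup G | IsCompact (K : Set G)}, (K : Set G))) (v : V) :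
    ρ g v = ((χ g : ℂˣ) : ℂ) • v := by
  induction hg using Subgroup.closure_induction generalizing v with
  | mem x hx =>
    obtain ⟨K, hK, hxK⟩ := Set.mem_iUnion₂.1 hx
    exact apply_eq_smul_of_forall_isConstituentOf_eq ρ hρ χ hχ τ hτ hconst K hK hxK v
  | one => rw [map_one, map_one, Units.val_one, one_smul, Module.End.one_apply]
  | mul x y _ _ hx hy => rw [map_mul, Module.End.mul_apply, hy, map_smul, hx, smul_smul, map_mul, Units.val_mul, mul_comm]
  | inv x _ hx =>
    have h1 : ρ x (ρ x⁻¹ v) = v := by rw [← Module.End.mul_apply, ← map_mul, mul_inv_cancel, map_one, Module.End.one_apply]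
    have h2 := hx (ρ x⁻¹ v)
    rw [h1] at h2
    -- `v = χ x • ρ x⁻¹ v`
    have h3 := congrArg (fun w => ((χ x : ℂˣ) : ℂ)⁻¹ • w) h2
    simp only [smul_smul, inv_mul_cancel₀ (Units.ne_zero (χ x)), one_smul] at h3
    rw [← h3, map_inv, Units.val_inv_eq_inv_val]

/-- **ED. 2. A group generated by its compact subgroups acts through `χ`** on a smooth representation whose only constituent is `⟦ℂ_χ⟧` (★ `SmoothIrrep.ofChar χ hχ`): if the subgroups
contained in compact sets generate `G` (`hgen`), then `ρ g v = χ(g) • v` for ALL `g`. [cite: BernsteinZelevinsky1976, §2.1–§2.3] [cite: BushnellHenniart2006, §2.3 Lemma; §9.1] -/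
theorem apply_eq_smul_of_forall_isConstituentOf_eq_mk_ofChar_of_closure_eq_top {V : Type} [AddCommGroup V] [Module ℂ V]
    (ρ : Representation ℂ G V) (hρ : ρ.IsSmooth) (χ : G →* ℂˣ) (hχ : IsOpen ((χ.ker : Subgroup G) : Set G))
    (hconst : ∀ c : IrrClass G, c.IsConstituentOf ρ → c = IrrClass.mk (SmoothIrrep.ofChar χ hχ))
    (hgen : Subgroup.closure (⋃ K ∈ {K : Subgroup G | IsCompact (K : Set G)}, (K : Set G)) = ⊤) (g : G) (v : V) :
    ρ g v = ((χ g : ℂˣ) : ℂ) • v :=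
  apply_eq_smul_of_forall_isConstituentOf_eq_of_mem_closure ρ hρ χ hχ (SmoothIrrep.ofChar χ hχ)
    (fun g z => by rw [SmoothIrrep.ofChar_ρ_apply]; rfl) hconst (by rw [hgen]; exact Subgroup.mem_top g) v

/-- **ED. 2. `χ = 1`: a group generated by its compact subgroups acts TRIVIALLY** on a smooth representation whose only constituent is the trivial character.
[cite: BernsteinZelevinsky1976, §2.1–§2.3] [cite: BushnellHenniart2006, §2.3 Lemma] -/
theorem apply_eq_self_of_forall_isConstituentOf_eq_mk_ofChar_one_of_closure_eq_top {V : Type} [AddCommGroup V] [Module ℂ V]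
    (ρ : Representation ℂ G V) (hρ : ρ.IsSmooth) (h1 : IsOpen (((1 : G →* ℂˣ).ker : Subgroup G) : Set G))
    (hconst : ∀ c : IrrClass G, c.IsConstituentOf ρ → c = IrrClass.mk (SmoothIrrep.ofChar 1 h1))
    (hgen : Subgroup.closure (⋃ K ∈ {K : Subgroup G | IsCompact (K : Set G)}, (K : Set G)) = ⊤) (g : G) (v : V) :
    ρ g v = v := by
  have h2 := apply_eq_smul_of_forall_isConstituentOf_eq_mk_ofChar_of_closure_eq_top ρ hρ 1 h1 hconst hgen g v
  rwa [MonoidHom.one_apply, Units.val_one, one_smul] at h2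

end IrrClass

end Literature.NumberTheory.Automorphic

end
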